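import Summits.QuantumFields.BalabanUV.Beta.EriceRemainderEnclosureHistoryAutonomyOrderMarkov

/-!
# EriceRemainderEnclosureHistoryAutonomyComparisonExcess — (E49j) THE EXCESS ALONG ONE TRAJECTORY: two estimates for the EFFECTIVE β-FUNCTIONS AT ONE PIN.
# `B` with zeroth moment `M ≥ 0` and floor `b > 0` on ]0,γ]; `B ≤ B′` on the box with ISOTONE EXCESS `B′ − B` (non-decreasing in the history); `h, h′` box
# solutions of `B`, `B′` from one pin `y`.  (1) SMALL PINS, no sign of `B`, no comparison assumed: `M·y ≤ (3√3∕2)·b ⟹ B h ≤ B′ h′` — the excess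
# `η = (B′ − B)(h′)` dominates every shifted excess along the decreasing `h′`, the core estimate of (E38a) read in the box ]0,y] with `η` on the shifts of
# `h′` only bounds `M·sup|h − h′| ≤ η·q∕(1 − q)`, `q = M·y∕(3√3·b) ≤ 1∕2`.  (2) UNDER COMPARISON FROM THE PIN (`h′ ≤ h`) with `B` ISOTONE and `M·y ≤ 3√3·b`:
# `B h ≤ B′ h′` — the levels differ by at most `j·η`, so `h_j − h′_j ≤ y∕(3√3·b)·η` and the memory drop is `≤ q·η ≤ η`.  These are the two inputs of
# (E49k) `…ComparisonIsotoneExcess` (isotone memory + isotone excess ⟹ comparison on the closed threshold)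

Cell `pub-balaban`, β-function sub-cell, BINDER row D4 «RemainderConst leaves for Bałaban's split» (`HOME/BINDER-OWNERS.md`; owner lineage `b2b-balaban-beta-an4`;
this file by co-owner #2 lineage `b2b-balaban-beta-d4-p2`, generation 46), β-FLOW TEAM duty (1), FREEZE (0) honoured (def-free; node U2's `MemFlow` ∕ `SeqBox` ∕
`picard` ∕ `drive` ∕ `invSq_eq_of_memFlow` ∕ `le_of_affine_contraction` ∕ `Sharpness.abs_sub_le_half_cube_mul`, (E37b)'s `abs_sub_shift_le_zm`, (E38a)'s
`weight_sharp_le` ∕ `le_inv_sqrt_of_le_inv_sq`, (E48a)'s `le_pin_of_memFlow` ∕ `strictAnti_of_memFlow` BY NAME, nothing restated).  Companion of (E49a)–(E49i).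

HONEST FRAMING (page 1, verbatim and binding).  *"Discharging BetaPertH makes Bałaban's UV stability UNCONDITIONAL — a real constructive-QFT result; it is
NOT the continuum limit and NOT the Clay problem."*  THIS FILE DISCHARGES NOTHING OF THE KIND.  Elementary real analysis about ABSTRACT functionals with
displayed zeroth moment, floor and sign of the EXCESS — hypotheses, not facts; nothing of Bałaban's (1.22) asserted (GAPS G-t4-U2-1∕-2).  Row D4 class
UNCHANGED (critical-path width 0; instance 0∕1; D4 DISCHARGE NO DATE).  HONEST DEPENDENCY: continuum YM on T⁴ ⇐ BetaPertH ∧ nine spine estimates (0/9 proved);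
BetaPertH ⇐ (D1) ∧ (D4) ∧ CAP+tail; G-an2-4 gates asym, D1 and NE2/3/4.

WHAT IS PROVED ([folklore]; 0 `def`, 0 sorry).  §1 `abs_drive_sub_drive_le_along`, **`abs_picard_sub_picard_le_along`** (the core estimate with `η` read on the
shifts of `h′` only).  §2 `seqBox_of_le_pin`, `seqBox_mono`, **`excess_shift_le`** (isotone excess is largest at the unshifted decreasing history),
**`effective_le_of_small_pin`**, **`effective_le_of_family_le_at`**.
-/
noncomputable section
open Filter Topology Finset Set

namespace Summit.QuantumFields.BalabanUV.Beta.EriceRemainderEnclosureHistoryAutonomyComparisonExcess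

open Literature.MathematicalPhysics.QuantumFieldTheory.Balaban1983to89
open Literature.MathematicalPhysics.QuantumFieldTheory.Balaban1983to89.T4BetaStationary
open Literature.MathematicalPhysics.QuantumFieldTheory.Balaban1983to89.T4BetaFlowWellPosed
open Literature.MathematicalPhysics.QuantumFieldTheory.Balaban1983to89.T4BetaFlowWellPosed.Sharpness (abs_sub_le_half_cube_mul)
open Summit.QuantumFields.BalabanUV.Beta.EriceRemainderEnclosureHistoryAutonomyWellPosed (abs_sub_shift_le_zm)
open Summit.QuantumFields.BalabanUV.Beta.EriceRemainderEnclosureHistoryAutonomyThreshold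
  (weight_sharp_le le_inv_sqrt_of_le_inv_sq three_sqrt_three_pos)
open Summit.QuantumFields.BalabanUV.Beta.EriceRemainderEnclosureHistoryAutonomyOrder
open Summit.QuantumFields.BalabanUV.Beta.EriceRemainderEnclosureHistoryAutonomyOrderMarkov

variable {B B' : (ℕ → ℝ) → ℝ} {M M' γ b η y : ℝ} {h h' : ℕ → ℝ} {S S' : ℝ → ℕ → ℝ}

/-! ## §1 The excess along ONE history: drive differences and the core estimate with `η` read on the shifts of `h′` only -/

/-- THE DRIVING SUMS of `B` (zeroth moment `M`) and `B′` on entrywise `D`-close box histories `h`, `h′` differ by at most `m·(M·D + η)` as soon as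
`|B − B′| ≤ η` ON THE SHIFTS OF `h′` (not on the whole box). [folklore] -/
theorem abs_drive_sub_drive_le_along
    (hB : ∀ u u' : ℕ → ℝ, SeqBox γ u → SeqBox γ u' → ∀ D : ℝ, (∀ j, |u j - u' j| ≤ D) → |B u - B u'| ≤ M * D)
    (hη : ∀ n, |B (fun j => h' (n + 1 + j)) - B' (fun j => h' (n + 1 + j))| ≤ η) (hh : SeqBox γ h) (hh' : SeqBox γ h') {D : ℝ}
    (hD : ∀ i, |h i - h' i| ≤ D) (m : ℕ) :
    |drive B h m - drive B' h' m| ≤ (m : ℝ) * (M * D + η) := by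
  unfold drive
  rw [← sum_sub_distrib]
  refine (abs_sum_le_sum_abs _ _).trans ?_
  have hterm : ∀ l ∈ range m, |B (fun j => h (l + 1 + j)) - B' (fun j => h' (l + 1 + j))| ≤ M * D + η := by
    intro l _
    have h1 := abs_sub_shift_le_zm hB hh hh' hD (l + 1)
    have h2 := hη l
    calc |B (fun j => h (l + 1 + j)) - B' (fun j => h' (l + 1 + j))|
        = |(B (fun j => h (l + 1 + j)) - B (fun j => h' (l + 1 + j)))
            + (B (fun j => h' (l + 1 + j)) - B' (fun j => h' (l + 1 + j)))| := by ring_nf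
      _ ≤ |B (fun j => h (l + 1 + j)) - B (fun j => h' (l + 1 + j))|
            + |B (fun j => h' (l + 1 + j)) - B' (fun j => h' (l + 1 + j))| := abs_add_le _ _
      _ ≤ M * D + η := add_le_add h1 h2
  calc ∑ l ∈ range m, |B (fun j => h (l + 1 + j)) - B' (fun j => h' (l + 1 + j))|
      ≤ ∑ l ∈ range m, (M * D + η) := sum_le_sum hterm
    _ = (m : ℝ) * (M * D + η) := by rw [sum_const, card_range, nsmul_eq_mul]

/-- **THE CORE ESTIMATE WITH THE EXCESS READ ALONG `h′`**: `B` with zeroth moment `M ≥ 0` and floor `b > 0`, `B′` with floor `b′ > 0`, on the box ]0,γ];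
ONE pin `p ∈ ]0,γ]`; box histories `h, h′` entrywise `D`-close; `|B − B′| ≤ η` on the shifts of `h′`.  Then at every scale
`|picard B p h m − picard B′ p h′ m| ≤ γ∕(3√3·b₀)·η + M·γ∕(3√3·b₀)·D`, `b₀ = min b b′` ((E38a)'s sharp weight). [folklore] -/
theorem abs_picard_sub_picard_le_along {b' p : ℝ}
    (hB : ∀ u u' : ℕ → ℝ, SeqBox γ u → SeqBox γ u' → ∀ D : ℝ, (∀ j, |u j - u' j| ≤ D) → |B u - B u'| ≤ M * D)
    (hM : 0 ≤ M) (hp : 0 < p) (hpγ : p ≤ γ) (hb : 0 < b) (hb' : 0 < b') (hlo : ∀ u, SeqBox γ u → b ≤ B u)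
    (hlo' : ∀ u, SeqBox γ u → b' ≤ B' u) (hh : SeqBox γ h) (hh' : SeqBox γ h') (hη0 : 0 ≤ η)
    (hη : ∀ n, |B (fun j => h' (n + 1 + j)) - B' (fun j => h' (n + 1 + j))| ≤ η) {D : ℝ} (hD : ∀ i, |h i - h' i| ≤ D) (m : ℕ) :
    |picard B p h m - picard B' p h' m| ≤
      γ / (3 * Real.sqrt 3 * min b b') * η + M * γ / (3 * Real.sqrt 3 * min b b') * D := by
  have hγ : 0 < γ := hp.trans_le hpγ
  have hD0 : 0 ≤ D := (abs_nonneg _).trans (hD 0)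
  have hb₀ : 0 < min b b' := lt_min hb hb'
  have hlo₀ : ∀ u, SeqBox γ u → min b b' ≤ B u := fun u hu => (min_le_left _ _).trans (hlo u hu)
  have hlo₀' : ∀ u, SeqBox γ u → min b b' ≤ B' u := fun u hu => (min_le_right _ _).trans (hlo' u hu)
  set a := picard B p h m with ha_def
  set a' := picard B' p h' m with ha'_def
  have ha : 0 < a := picard_pos hp hb hlo hh m
  have ha' : 0 < a' := picard_pos hp hb' hlo' hh' m
  have hSa : 1 / a ^ 2 = 1 / p ^ 2 + drive B h m := one_div_picard_sq hp hb hlo hh m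
  have hSa' : 1 / a' ^ 2 = 1 / p ^ 2 + drive B' h' m := one_div_picard_sq hp hb' hlo' hh' m
  set P : ℝ := 1 / γ ^ 2 + (m : ℝ) * min b b' with hP
  have hmb : (0 : ℝ) ≤ (m : ℝ) * min b b' := mul_nonneg (Nat.cast_nonneg m) hb₀.le
  have hP0 : 0 < P := by positivity
  have hpin : 1 / γ ^ 2 ≤ 1 / p ^ 2 := one_div_le_one_div_of_le (by positivity) (pow_le_pow_left₀ hp.le hpγ 2)
  have haP : P ≤ 1 / a ^ 2 := by rw [hSa]; exact add_le_add hpin (mul_lower_le_drive hlo₀ hh m)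
  have ha'P : P ≤ 1 / a' ^ 2 := by rw [hSa']; exact add_le_add hpin (mul_lower_le_drive hlo₀' hh' m)
  set C : ℝ := 1 / Real.sqrt P with hC
  have haC : a ≤ C := le_inv_sqrt_of_le_inv_sq ha hP0 haP
  have ha'C : a' ≤ C := le_inv_sqrt_of_le_inv_sq ha' hP0 ha'P
  have hC0 : 0 < C := lt_of_lt_of_le ha haC
  have hw := abs_sub_le_half_cube_mul ha ha' haC ha'C
  have hdiff : |1 / a ^ 2 - 1 / a' ^ 2| ≤ (m : ℝ) * (M * D + η) := by
    rw [hSa, hSa', show (1 : ℝ) / p ^ 2 + drive B h m - (1 / p ^ 2 + drive B' h' m) = drive B h m - drive B' h' m by ring]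
    exact abs_drive_sub_drive_le_along hB hη hh hh' hD m
  have hW2 : (m : ℝ) * (C ^ 3 / 2) ≤ γ / (3 * Real.sqrt 3 * min b b') := weight_sharp_le hγ hb₀ m
  have hE0 : 0 ≤ M * D + η := by positivity
  calc |a - a'| ≤ C ^ 3 / 2 * |1 / a ^ 2 - 1 / a' ^ 2| := hw
    _ ≤ C ^ 3 / 2 * ((m : ℝ) * (M * D + η)) := mul_le_mul_of_nonneg_left hdiff (by positivity)
    _ = (m : ℝ) * (C ^ 3 / 2) * (M * D + η) := by ring
    _ ≤ γ / (3 * Real.sqrt 3 * min b b') * (M * D + η) := mul_le_mul_of_nonneg_right hW2 hE0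
    _ = γ / (3 * Real.sqrt 3 * min b b') * η + M * γ / (3 * Real.sqrt 3 * min b b') * D := by ring


/-! ## §2 The effective β-functions at ONE pin: the small-pin estimate and the estimate under comparison from that pin -/

/-- A box history with values `≤ y ≤ γ` lies in the smaller box ]0,y]. [folklore] -/
theorem seqBox_of_le_pin (hh : SeqBox γ h) (hle : ∀ j, h j ≤ y) : SeqBox y h := fun j => ⟨(hh j).1, hle j⟩

/-- Restriction of a box hypothesis to a smaller box: `SeqBox y u → SeqBox γ u` for `y ≤ γ`. [folklore] -/
theorem seqBox_mono (hyγ : y ≤ γ) {u : ℕ → ℝ} (hu : SeqBox y u) : SeqBox γ u := fun j => ⟨(hu j).1, (hu j).2.trans hyγ⟩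

/-- Along a DECREASING box history `h′` the ISOTONE excess `B′ − B` is largest at the unshifted history: `0 ≤ (B′ − B)(h′(n+1+·)) ≤ (B′ − B)(h′)`.
[folklore] -/
theorem excess_shift_le (hexc : ∀ u, SeqBox γ u → B u ≤ B' u)
    (hDmono : ∀ u v : ℕ → ℝ, SeqBox γ u → SeqBox γ v → (∀ j, u j ≤ v j) → B' u - B u ≤ B' v - B v)
    (hh' : SeqBox γ h') (hanti : Antitone h') (n : ℕ) :
    |B (fun j => h' (n + 1 + j)) - B' (fun j => h' (n + 1 + j))| ≤ B' h' - B h' := by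
  have h1 : B (fun j => h' (n + 1 + j)) ≤ B' (fun j => h' (n + 1 + j)) := hexc _ (seqBox_shift hh' (n + 1))
  have h2 := hDmono _ _ (seqBox_shift hh' (n + 1)) hh' fun j => hanti (Nat.le_add_left j (n + 1))
  rw [abs_sub_comm, abs_of_nonneg (by linarith)]
  exact h2

/-- **THE SMALL-PIN ESTIMATE.**  `B` with zeroth moment `M ≥ 0` and floor `b > 0` on ]0,γ] (no sign needed here); `B ≤ B′` on the box with ISOTONE EXCESS `B′ − B`; `h`,
`h′` box solutions of `B`, `B′` from ONE pin `y ∈ ]0,γ]` with `M·y ≤ (3√3∕2)·b`.  Then `B h ≤ B′ h′` — the effective β-functions are ordered AT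
`y` — WITHOUT any comparison assumed: the excess `η = (B′ − B)(h′)` dominates `M·sup|h − h′| ≤ η·q∕(1−q)`, `q = M·y∕(3√3·b) ≤ 1∕2`
(the core estimate in the box ]0,y] closed by node U2's `le_of_affine_contraction`). [folklore] -/
theorem effective_le_of_small_pin
    (hB : ∀ u u' : ℕ → ℝ, SeqBox γ u → SeqBox γ u' → ∀ D : ℝ, (∀ j, |u j - u' j| ≤ D) → |B u - B u'| ≤ M * D)
    (hM : 0 ≤ M) (hb : 0 < b) (hlo : ∀ u, SeqBox γ u → b ≤ B u) (hexc : ∀ u, SeqBox γ u → B u ≤ B' u)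
    (hDmono : ∀ u v : ℕ → ℝ, SeqBox γ u → SeqBox γ v → (∀ j, u j ≤ v j) → B' u - B u ≤ B' v - B v)
    (hy : 0 < y) (hyγ : y ≤ γ) (hsmall : M * y ≤ 3 * Real.sqrt 3 / 2 * b)
    (hh : SeqBox γ h) (hf : MemFlow B y h) (hh' : SeqBox γ h') (hf' : MemFlow B' y h') : B h ≤ B' h' := by
  have hlo' : ∀ u, SeqBox γ u → b ≤ B' u := fun u hu => (hlo u hu).trans (hexc u hu)
  -- both solutions live in the box ]0,y]
  have hhy : SeqBox y h := seqBox_of_le_pin hh (le_pin_of_memFlow hb hlo hh hf)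
  have hh'y : SeqBox y h' := seqBox_of_le_pin hh' (le_pin_of_memFlow hb hlo' hh' hf')
  have hanti' : Antitone h' := (strictAnti_of_memFlow hb hlo' hh' hf').antitone
  -- hypotheses restricted to the box ]0,y]
  have hBy : ∀ u u' : ℕ → ℝ, SeqBox y u → SeqBox y u' → ∀ D : ℝ, (∀ j, |u j - u' j| ≤ D) → |B u - B u'| ≤ M * D :=
    fun u u' hu hu' D hD => hB u u' (seqBox_mono hyγ hu) (seqBox_mono hyγ hu') D hD
  have hloy : ∀ u, SeqBox y u → b ≤ B u := fun u hu => hlo u (seqBox_mono hyγ hu)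
  have hlo'y : ∀ u, SeqBox y u → b ≤ B' u := fun u hu => hlo' u (seqBox_mono hyγ hu)
  -- the excess along h′
  set η : ℝ := B' h' - B h' with hη_def
  have hη0 : 0 ≤ η := by rw [hη_def]; linarith [hexc h' hh']
  have hηs : ∀ n, |B (fun j => h' (n + 1 + j)) - B' (fun j => h' (n + 1 + j))| ≤ η := excess_shift_le hexc hDmono hh' hanti'
  -- the contraction constant
  have h33 : 0 < 3 * Real.sqrt 3 * b := mul_pos three_sqrt_three_pos hb
  set q : ℝ := M * y / (3 * Real.sqrt 3 * min b b) with hq_def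
  have hminb : min b b = b := min_self b
  have hq0 : 0 ≤ q := by rw [hq_def, hminb]; exact div_nonneg (mul_nonneg hM hy.le) h33.le
  have hq12 : q ≤ 1 / 2 := by
    rw [hq_def, hminb, div_le_iff₀ h33]; linarith
  have hq1 : q < 1 := by linarith
  -- the bootstrap: δ ≤ A + q δ ⟹ δ ≤ A/(1−q)
  set A : ℝ := y / (3 * Real.sqrt 3 * min b b) * η with hA_def
  have hA0 : 0 ≤ A := by rw [hA_def, hminb]; exact mul_nonneg (div_nonneg hy.le h33.le) hη0
  have hfix : picard B y h = h := picard_eq_of_memFlow hf fun j => (hh j).1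
  have hfix' : picard B' y h' = h' := picard_eq_of_memFlow hf' fun j => (hh' j).1
  have hstep : ∀ D : ℝ, (∀ i, |h i - h' i| ≤ D) → ∀ i, |h i - h' i| ≤ A + q * D := by
    intro D hD i
    have := abs_picard_sub_picard_le_along hBy hM hy le_rfl hb hb hloy hlo'y hhy hh'y hη0 hηs hD i
    rw [hfix, hfix'] at this
    simpa [hA_def, hq_def, mul_comm, mul_left_comm, mul_assoc] using this
  have hδ := le_of_affine_contraction hq0 hq1 hA0 (fun i => abs_sub_le_of_seqBox hhy hh'y i) hstep
  -- the memory drop is at most M·A/(1−q) = η·q/(1−q) ≤ η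
  have hdrop : |B h - B h'| ≤ M * (A / (1 - q)) := hB h h' hh hh' _ hδ
  have hMA : M * (A / (1 - q)) = η * (q / (1 - q)) := by
    rw [hA_def, hq_def, hminb]; field_simp
  have hqq : q / (1 - q) ≤ 1 := by rw [div_le_one (by linarith)]; linarith
  have h1 : B h - B h' ≤ η := by
    have := (abs_le.mp hdrop).2
    rw [hMA] at this
    exact this.trans ((mul_le_mul_of_nonneg_left hqq hη0).trans_eq (mul_one η))
  rw [hη_def] at h1
  linarith

/-- **THE ESTIMATE UNDER COMPARISON FROM THE PIN.**  Same functionals; `h, h′` box solutions of `B`, `B′` from one pin `y ∈ ]0,γ]` with `h′ ≤ h` at every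
scale and `M·y ≤ 3√3·b`.  Then `B h ≤ B′ h′`: the levels differ by at most `j·η` (isotone `B`, ordered histories), so `h_j − h′_j ≤ (c_j³∕2)·j·η ≤
y∕(3√3·b)·η` and the memory drop `B h − B h′ ≤ q·η ≤ η`. [folklore] -/
theorem effective_le_of_family_le_at
    (hmono : ∀ u v : ℕ → ℝ, SeqBox γ u → SeqBox γ v → (∀ j, u j ≤ v j) → B u ≤ B v)
    (hB : ∀ u u' : ℕ → ℝ, SeqBox γ u → SeqBox γ u' → ∀ D : ℝ, (∀ j, |u j - u' j| ≤ D) → |B u - B u'| ≤ M * D)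
    (hb : 0 < b) (hlo : ∀ u, SeqBox γ u → b ≤ B u) (hexc : ∀ u, SeqBox γ u → B u ≤ B' u)
    (hDmono : ∀ u v : ℕ → ℝ, SeqBox γ u → SeqBox γ v → (∀ j, u j ≤ v j) → B' u - B u ≤ B' v - B v)
    (hy : 0 < y) (hsmall : M * y ≤ 3 * Real.sqrt 3 * b)
    (hh : SeqBox γ h) (hf : MemFlow B y h) (hh' : SeqBox γ h') (hf' : MemFlow B' y h') (hle : ∀ j, h' j ≤ h j) : B h ≤ B' h' := by
  have hlo' : ∀ u, SeqBox γ u → b ≤ B' u := fun u hu => (hlo u hu).trans (hexc u hu)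
  have hanti' : Antitone h' := (strictAnti_of_memFlow hb hlo' hh' hf').antitone
  set η : ℝ := B' h' - B h' with hη_def
  have hη0 : 0 ≤ η := by rw [hη_def]; linarith [hexc h' hh']
  have hηs : ∀ n, |B (fun j => h' (n + 1 + j)) - B' (fun j => h' (n + 1 + j))| ≤ η := excess_shift_le hexc hDmono hh' hanti'
  have h33 : 0 < 3 * Real.sqrt 3 * b := mul_pos three_sqrt_three_pos hb
  -- levels: 0 ≤ a′_j − a_j ≤ j·η
  have hlev : ∀ j, 1 / h' j ^ 2 - 1 / h j ^ 2 ≤ (j : ℝ) * η := by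
    intro j
    rw [invSq_eq_of_memFlow hf j, invSq_eq_of_memFlow hf' j, show (1:ℝ) / y ^ 2 + drive B' h' j - (1 / y ^ 2 + drive B h j)
      = drive B' h' j - drive B h j by ring]
    unfold drive
    rw [← sum_sub_distrib]
    calc ∑ l ∈ range j, (B' (fun k => h' (l + 1 + k)) - B (fun k => h (l + 1 + k)))
        ≤ ∑ _l ∈ range j, η := sum_le_sum fun l _ => by
          have e1 := (abs_le.mp (hηs l)).1
          have e2 := hmono _ _ (seqBox_shift hh' (l + 1)) (seqBox_shift hh (l + 1)) fun k => hle (l + 1 + k)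
          linarith
      _ = (j : ℝ) * η := by rw [sum_const, card_range, nsmul_eq_mul]
  have hlev0 : ∀ j, 0 ≤ 1 / h' j ^ 2 - 1 / h j ^ 2 := fun j =>
    sub_nonneg.mpr (one_div_le_one_div_of_le (pow_pos (hh' j).1 2) (pow_le_pow_left₀ (hh' j).1.le (hle j) 2))
  -- the gap h_j − h′_j ≤ (c_j³/2)·j·η ≤ y/(3√3 b)·η
  have hgap : ∀ j, |h j - h' j| ≤ y / (3 * Real.sqrt 3 * b) * η := by
    intro j
    set P : ℝ := 1 / y ^ 2 + (j : ℝ) * b with hP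
    have hP0 : 0 < P := by positivity
    have hjP : P ≤ 1 / h j ^ 2 := by rw [invSq_eq_of_memFlow hf j]; exact add_le_add le_rfl (mul_lower_le_drive hlo hh j)
    have hjP' : P ≤ 1 / h' j ^ 2 := by rw [invSq_eq_of_memFlow hf' j]; exact add_le_add le_rfl (mul_lower_le_drive hlo' hh' j)
    set C : ℝ := 1 / Real.sqrt P with hC
    have hC : h j ≤ C := le_inv_sqrt_of_le_inv_sq (hh j).1 hP0 hjP
    have hC' : h' j ≤ C := le_inv_sqrt_of_le_inv_sq (hh' j).1 hP0 hjP'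
    have hw := abs_sub_le_half_cube_mul (hh j).1 (hh' j).1 hC hC'
    have hW : (j : ℝ) * (C ^ 3 / 2) ≤ y / (3 * Real.sqrt 3 * b) := weight_sharp_le hy hb j
    have habs : |1 / h j ^ 2 - 1 / h' j ^ 2| ≤ (j : ℝ) * η := by
      rw [abs_sub_comm, abs_of_nonneg (hlev0 j)]; exact hlev j
    calc |h j - h' j| ≤ C ^ 3 / 2 * |1 / h j ^ 2 - 1 / h' j ^ 2| := hw
      _ ≤ C ^ 3 / 2 * ((j : ℝ) * η) := mul_le_mul_of_nonneg_left habs (by positivity)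
      _ = (j : ℝ) * (C ^ 3 / 2) * η := by ring
      _ ≤ y / (3 * Real.sqrt 3 * b) * η := mul_le_mul_of_nonneg_right hW hη0
  have hdrop : |B h - B h'| ≤ M * (y / (3 * Real.sqrt 3 * b) * η) := hB h h' hh hh' _ hgap
  have hq : M * (y / (3 * Real.sqrt 3 * b) * η) ≤ η := by
    rw [show M * (y / (3 * Real.sqrt 3 * b) * η) = (M * y / (3 * Real.sqrt 3 * b)) * η by ring]
    have : M * y / (3 * Real.sqrt 3 * b) ≤ 1 := by rw [div_le_one h33]; exact hsmall
    exact (mul_le_mul_of_nonneg_right this hη0).trans_eq (one_mul η)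
  have h1 := (abs_le.mp hdrop).2
  rw [hη_def] at hq
  linarith

end Summit.QuantumFields.BalabanUV.Beta.EriceRemainderEnclosureHistoryAutonomyComparisonExcess

end
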